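import Literature.AlgebraicGeometry.Resolution.EffectiveResolutionSpreadModel
import Literature.AlgebraicGeometry.Resolution.PolynomialQuotientBaseChange
import HarnessLib

/-!
# BGMW 2011 Cor. 8.0.6 (weak form) from resolution of marked ideals in characteristic zero

Topic: `Literature/AlgebraicGeometry/Resolution`. Final assembly of the spreading-out proof of
the named fact `BierstoneGrigorievMilmanWlodarczyk2011` (`EffectiveResolution.lean`: for
`k` perfect of characteristic `p > M(d, n, l)` and `S ⊆ k[x₁, …, xₙ]`, `|S| ≤ l`, degrees `≤ d`,
with `V(S)` integral, `V(S)` has a resolution of singularities):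

* `map_eq_of_C_mul_pow_mem` — an ideal `J ⊇ F` of `A[x]` generated by elements `g` with
  `C a_g · g ^ m ∈ F`, `a_g ↦ unit`, extends to the same ideal of `k[x]` as `F` as soon as
  `F k[x]` is radical;
* `exists_forall_hasResolution_affineZeroLocus` — **spreading**: for `A` a Noetherian domain
  with fraction field `K` of characteristic zero over which all marked ideals
  `(𝔸ⁿ_K, 𝓘_{V(S')}, ∅, 1)` with `(S')` prime are resolvable, and `F ⊆ A[x]` finite, there is
  `a ≠ 0` such that at every field-valued point `φ : A → k` of `D(a)` at which `V(φ F)` is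
  integral, `V(φ F)` has a resolution. Cases on the generic member `rad = √(F K[x])`:
  `rad = ⊤` (then `V(φF) = ∅` near the generic point), `rad` not prime (then `V(φF)` is not
  integral near the generic point, `exists_forall_not_isDomain_tensor`), `rad` prime (the model
  theorem `exists_forall_hasResolution_pullback`, `EffectiveResolutionSpreadModel.lean`, the
  fibre `Spec (A[x] ⧸ ψ⁻¹rad) ×_A k` being identified with `V(φF)` through
  `polyQuotientBaseChangeEquiv`, `map_eq_of_C_mul_pow_mem` and `pullbackSpecIso`);
* `bierstoneGrigorievMilmanWlodarczyk2011_of_charZero` — **(C0) →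
  `BierstoneGrigorievMilmanWlodarczyk2011`**, where (C0) = resolution of the marked ideals
  `(𝔸ⁿ_K, (S), ∅, 1)` over every field `K` of characteristic zero
  (`∀ K [CharZero K] n S, HasMarkedResolution K n S`, written out as the hypothesis; not a
  declaration of the tree, see `EffectiveResolutionSpread.lean`), by the Noetherian induction of
  `LargeCharacteristic.lean` on `Spec ℤ[c]` (universal coefficients,
  `EffectiveResolutionSpread.lean`), with a NON-explicit bound `M(d, n, l)`;
* `bierstoneGrigorievMilmanWlodarczyk2011_of_kollar` — hence from Kollár's Thm. 3.69
  (`Kollar2007MarkedOrderReduction`, the characteristic-zero named fact of the tree, which gives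
  (C0): `charZeroMarkedResolution_of_kollar`).

On this line the positive-characteristic algorithm of BGMW §8 and its multiplicity bound
(Lemma 8.0.3, §§5–7) are replaced by the characteristic-zero theorem plus spreading out; the
marked-ideal spreading statement `SpreadsFromGenericPoint` of `EffectiveResolutionSpread.lean`
is thereby bypassed (it remains true but unproved).

## Sources

* E. Bierstone, D. Grigoriev, P. Milman, J. Włodarczyk, arXiv:1206.3090, Cor. 8.0.6 (numbering
  as in `EffectiveResolution.lean`). [BierstoneGrigorievMilmanWlodarczyk2011]
* J. Kollár, *Lectures on Resolution of Singularities* (2007), Thm. 3.69. [Kollar2007]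
* A. Grothendieck, EGA IV₃ §8 (spreading out). [folklore]
-/

noncomputable section

open CategoryTheory CategoryTheory.Limits AlgebraicGeometry TopologicalSpace MvPolynomial
  TensorProduct

namespace Literature.AlgebraicGeometry.Resolution

attribute [local instance] MvPolynomial.algebraMvPolynomial

/-! ## Algebra -/

/-- If `J = (G) ⊇ F` in `A[x]` with `C a_g · g ^ m ∈ F` for each generator `g`, where the
`a_g` are units in the field `k`, and `F k[x]` is radical, then `J k[x] = F k[x]`. [folklore] -/
theorem map_eq_of_C_mul_pow_mem {A k : Type*} [CommRing A] [Field k] [Algebra A k] {σ : Type*}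
    {F J : Ideal (MvPolynomial σ A)} (hFJ : F ≤ J) (G : Finset (MvPolynomial σ A))
    (hG : Ideal.span (G : Set (MvPolynomial σ A)) = J)
    (hnil : ∀ g ∈ G, ∃ (m : ℕ) (a : A), algebraMap A k a ≠ 0 ∧ C a * g ^ m ∈ F)
    (hrad : (F.map (MvPolynomial.map (algebraMap A k))).IsRadical) :
    J.map (MvPolynomial.map (algebraMap A k)) = F.map (MvPolynomial.map (algebraMap A k)) := by
  refine le_antisymm ?_ (Ideal.map_mono hFJ)
  rw [← hG, Ideal.map_span, Ideal.span_le]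
  rintro _ ⟨g, hg, rfl⟩
  obtain ⟨m, a, ha, hmem⟩ := hnil g hg
  apply hrad
  refine ⟨m, ?_⟩
  have h1 : MvPolynomial.map (algebraMap A k) (C a * g ^ m) ∈
      F.map (MvPolynomial.map (algebraMap A k)) := Ideal.mem_map_of_mem _ hmem
  rw [map_mul, map_pow, MvPolynomial.map_C] at h1
  have hu : IsUnit (C (algebraMap A k a) : MvPolynomial σ k) := (isUnit_iff_ne_zero.mpr ha).map C
  exact (Ideal.unit_mul_mem_iff_mem _ hu).mp h1

/-- `map g (univPoly f) = univPoly (g ∘ f)`. [folklore] -/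
theorem map_univPoly (n d l : ℕ) {A B : Type} [CommRing A] [CommRing B] (f : CoeffRing n d l →+* A)
    (g : A →+* B) (j : Fin l) :
    MvPolynomial.map g (univPoly n d l f j) = univPoly n d l (g.comp f) j := by
  unfold univPoly
  rw [map_sum]
  refine Finset.sum_congr rfl fun e _ => ?_
  rw [MvPolynomial.map_monomial]
  rfl

open scoped Classical in
/-- `univFamily (g ∘ f)` is the image of `univFamily f` under `map g`. [folklore] -/
theorem univFamily_comp (n d l : ℕ) {A B : Type} [CommRing A] [CommRing B] (f : CoeffRing n d l →+* A)
    (g : A →+* B) :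
    univFamily n d l (g.comp f) = (univFamily n d l f).image (MvPolynomial.map g) := by
  classical
  unfold univFamily
  rw [Finset.image_image]
  congr 1
  funext j
  exact (map_univPoly n d l f g j).symm

/-! ## The fibres `V(φF)` as fibres of `Spec (A[x] ⧸ J) → Spec A` -/

section Fibres

variable {A : Type} [CommRing A] {n : ℕ} (J : Ideal (MvPolynomial (Fin n) A))
  (k : Type) [Field k] [Algebra A k]

/-- An isomorphism `V(S) ≅ Spec (A[x] ⧸ J) ×_A Spec k` (an `IsIso` morphism) once the ideals
`J k[x]` and `(S)` of `k[x]` coincide. [folklore] -/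
theorem exists_isIso_affineZeroLocus_pullback (S : Finset (MvPolynomial (Fin n) k))
    (hJS : polyBaseChange J k = Ideal.span (S : Set (MvPolynomial (Fin n) k))) :
    ∃ e : affineZeroLocus k n S ⟶
        pullback (Spec.map (CommRingCat.ofHom (algebraMap A (MvPolynomial (Fin n) A ⧸ J))))
          (Spec.map (CommRingCat.ofHom (algebraMap A k))), IsIso e := by
  let eR : ((MvPolynomial (Fin n) A ⧸ J) ⊗[A] k) ≃+* (MvPolynomial (Fin n) k ⧸ polyBaseChange J k) :=
    (polyQuotientBaseChangeEquiv k J).toRingEquiv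
  let i₁ : CommRingCat.of (MvPolynomial (Fin n) k ⧸ polyBaseChange J k) ≅
      CommRingCat.of (MvPolynomial (Fin n) k ⧸ Ideal.span (S : Set (MvPolynomial (Fin n) k))) :=
    (Ideal.quotEquivOfEq hJS).toCommRingCatIso
  let i₂ : CommRingCat.of ((MvPolynomial (Fin n) A ⧸ J) ⊗[A] k) ≅
      CommRingCat.of (MvPolynomial (Fin n) k ⧸ polyBaseChange J k) := eR.toCommRingCatIso
  have hiso : IsIso (Spec.map i₁.hom ≫ Spec.map i₂.hom ≫
      (pullbackSpecIso A (MvPolynomial (Fin n) A ⧸ J) k).inv) := inferInstance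
  exact ⟨_, hiso⟩

/-- The coordinate ring of `V(S)` is a domain when `V(S)` is integral. [folklore] -/
theorem isDomain_of_isIntegral_affineZeroLocus (S : Finset (MvPolynomial (Fin n) k))
    (h : IsIntegral (affineZeroLocus k n S)) :
    IsDomain (MvPolynomial (Fin n) k ⧸ Ideal.span (S : Set (MvPolynomial (Fin n) k))) := by
  haveI : IsIntegral (Spec (CommRingCat.of
    (MvPolynomial (Fin n) k ⧸ Ideal.span (S : Set (MvPolynomial (Fin n) k))))) := h
  have hd : IsDomain Γ(Spec (CommRingCat.of
    (MvPolynomial (Fin n) k ⧸ Ideal.span (S : Set (MvPolynomial (Fin n) k)))), ⊤) := inferInstance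
  exact MulEquiv.isDomain _ (Scheme.ΓSpecIso (CommRingCat.of
    (MvPolynomial (Fin n) k ⧸ Ideal.span (S : Set (MvPolynomial (Fin n) k))))).symm.commRingCatIsoToRingEquiv.toMulEquiv

end Fibres

/-! ## Spreading out over a Noetherian domain of characteristic zero -/

section Spread

variable {A : Type} [CommRing A] [IsDomain A] [IsNoetherianRing A] (K : Type) [Field K]
  [CharZero K] [Algebra A K] [IsFractionRing A K] {n : ℕ}

omit [IsDomain A] [IsNoetherianRing A] [CharZero K] in
/-- Primes of `A[x] ⧸ ψ⁻¹(rad)` from primes of `K[x]` above `rad`, lying over `(0) ⊆ A`.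
[folklore] -/
theorem exists_prime_quotient_of_prime {rad 𝔮 : Ideal (MvPolynomial (Fin n) K)} [𝔮.IsPrime]
    (h𝔮 : rad ≤ 𝔮) {r : MvPolynomial (Fin n) A}
    (hr : algebraMap (MvPolynomial (Fin n) A) (MvPolynomial (Fin n) K) r ∉ 𝔮) :
    ∃ P : Ideal (MvPolynomial (Fin n) A ⧸
        rad.comap (algebraMap (MvPolynomial (Fin n) A) (MvPolynomial (Fin n) K))),
      P.IsPrime ∧ Ideal.Quotient.mk _ r ∉ P ∧
        P.comap (algebraMap A _) = ⊥ := by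
  set ψ := algebraMap (MvPolynomial (Fin n) A) (MvPolynomial (Fin n) K) with hψ
  set J := rad.comap ψ with hJ
  have hJ𝔮 : J ≤ 𝔮.comap ψ := Ideal.comap_mono h𝔮
  haveI : (𝔮.comap ψ).IsPrime := Ideal.comap_isPrime ψ 𝔮
  have hker : RingHom.ker (Ideal.Quotient.mk J) ≤ 𝔮.comap ψ := by rwa [Ideal.mk_ker]
  refine ⟨(𝔮.comap ψ).map (Ideal.Quotient.mk J),
    Ideal.map_isPrime_of_surjective Ideal.Quotient.mk_surjective hker, ?_, ?_⟩
  · intro hmem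
    rw [Ideal.mem_map_iff_of_surjective _ Ideal.Quotient.mk_surjective] at hmem
    obtain ⟨r', hr', heq⟩ := hmem
    rw [Ideal.Quotient.eq, ← neg_sub, Ideal.neg_mem_iff] at heq
    have : r ∈ 𝔮.comap ψ := by
      have := (𝔮.comap ψ).add_mem hr' (hJ𝔮 heq)
      rwa [add_sub_cancel] at this
    exact hr this
  · rw [eq_bot_iff]
    intro a ha
    rw [Ideal.mem_comap, IsScalarTower.algebraMap_apply A (MvPolynomial (Fin n) A),
      Ideal.Quotient.algebraMap_eq, Ideal.mem_map_iff_of_surjective _ Ideal.Quotient.mk_surjective] at ha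
    obtain ⟨r', hr', heq⟩ := ha
    rw [Ideal.Quotient.eq, ← neg_sub, Ideal.neg_mem_iff] at heq
    have hCa : (algebraMap A (MvPolynomial (Fin n) A) a) ∈ 𝔮.comap ψ := by
      have := (𝔮.comap ψ).add_mem hr' (hJ𝔮 heq)
      rwa [add_sub_cancel] at this
    rw [MvPolynomial.algebraMap_eq, Ideal.mem_comap] at hCa
    by_contra ha0
    exact (inferInstance : 𝔮.IsPrime).ne_top (Ideal.eq_top_of_isUnit_mem _ hCa (isUnit_algebraMap_C K ha0))

open scoped Classical in
/-- **Spreading out a resolution of singularities from characteristic zero.** Let `A` be a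
Noetherian domain with fraction field `K` of characteristic zero such that every marked ideal
`(𝔸ⁿ_K, 𝓘_{V(S')}, ∅, 1)` with `(S')` prime has a resolution, and `F ⊆ A[x₁, …, xₙ]` finite. Then
there is `a ≠ 0` in `A` such that for every field-valued point `φ : A → k` with `φ a ≠ 0` at which
the zero scheme `V(φF) ⊆ 𝔸ⁿ_k` is integral, `V(φF)` has a resolution of singularities.
[cite: BierstoneGrigorievMilmanWlodarczyk2011, Cor. 8.0.6] -/
theorem exists_forall_hasResolution_affineZeroLocus
    (hres : ∀ S' : Finset (MvPolynomial (Fin n) K),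
      (Ideal.span (S' : Set (MvPolynomial (Fin n) K))).IsPrime → HasMarkedResolution K n S')
    (F : Finset (MvPolynomial (Fin n) A)) :
    ∃ a : A, a ≠ 0 ∧ ∀ (k : Type) [Field k] (φ : A →+* k), φ a ≠ 0 →
      IsIntegral (affineZeroLocus k n (F.image (MvPolynomial.map φ))) →
      Scheme.HasResolution (affineZeroLocus k n (F.image (MvPolynomial.map φ))) := by
  classical
  haveI := isLocalization_mvPolynomial (A := A) K (n := n)
  set ψ : MvPolynomial (Fin n) A →+* MvPolynomial (Fin n) K :=
    algebraMap (MvPolynomial (Fin n) A) (MvPolynomial (Fin n) K) with hψdef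
  have hψinj : Function.Injective ψ := by
    rw [hψdef, MvPolynomial.algebraMap_def]
    exact MvPolynomial.map_injective _ (IsFractionRing.injective A K)
  set FI : Ideal (MvPolynomial (Fin n) A) := Ideal.span (F : Set (MvPolynomial (Fin n) A)) with hFIdef
  set rad : Ideal (MvPolynomial (Fin n) K) := (FI.map ψ).radical with hraddef
  set J : Ideal (MvPolynomial (Fin n) A) := rad.comap ψ with hJdef
  have hFJ : FI ≤ J := (Ideal.le_comap_map).trans (Ideal.comap_mono Ideal.le_radical)
  -- generators of `J` and their nil-mod-torsion witnesses
  obtain ⟨G, hG⟩ := (inferInstance : IsNoetherianRing (MvPolynomial (Fin n) A)).noetherian J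
  have hnil : ∀ g ∈ G, ∃ (m : ℕ) (a : A), a ≠ 0 ∧ C a * g ^ m ∈ FI := by
    intro g hg
    have hgJ : g ∈ J := hG ▸ Ideal.subset_span hg
    obtain ⟨m, hm⟩ : ∃ m : ℕ, ψ g ^ m ∈ FI.map ψ := Ideal.mem_comap.mp hgJ
    rw [← map_pow, IsLocalization.mem_map_algebraMap_iff ((nonZeroDivisors A).map (C : A →+* (MvPolynomial (Fin n) A))) (MvPolynomial (Fin n) K)]
      at hm
    obtain ⟨⟨⟨f, hf⟩, ⟨_, ⟨a, ha, rfl⟩⟩⟩, heq⟩ := hm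
    refine ⟨m, a, nonZeroDivisors.ne_zero ha, ?_⟩
    change ψ (g ^ m) * ψ (C a) = ψ f at heq
    rw [← map_mul] at heq
    rw [mul_comm, hψinj heq]
    exact hf
  choose m a ha0 hmem using hnil
  set a₃ : A := ∏ g ∈ G.attach, a g g.2 with ha₃def
  have ha₃0 : a₃ ≠ 0 := Finset.prod_ne_zero_iff.mpr fun g _ => ha0 g g.2
  -- at points of `D(a₃)` with `V(φF)` integral: `J k[x] = (φF)`
  have key : ∀ (k : Type) [Field k] [Algebra A k], algebraMap A k a₃ ≠ 0 →
      IsIntegral (affineZeroLocus k n (F.image (MvPolynomial.map (algebraMap A k)))) →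
      polyBaseChange J k = Ideal.span ((F.image (MvPolynomial.map (algebraMap A k)) :
        Finset (MvPolynomial (Fin n) k)) : Set (MvPolynomial (Fin n) k)) := by
    intro k _ _ hφ hint
    have hφ' : ∀ g (hg : g ∈ G), algebraMap A k (a g hg) ≠ 0 := by
      intro g hg
      rw [ha₃def, map_prod] at hφ
      exact Finset.prod_ne_zero_iff.mp hφ ⟨g, hg⟩ (Finset.mem_attach _ _)
    have hspan : Ideal.span ((F.image (MvPolynomial.map (algebraMap A k)) :
        Finset (MvPolynomial (Fin n) k)) : Set (MvPolynomial (Fin n) k)) =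
        FI.map (MvPolynomial.map (algebraMap A k)) := by
      rw [Finset.coe_image, hFIdef, Ideal.map_span]
    have hdom := isDomain_of_isIntegral_affineZeroLocus k
      (F.image (MvPolynomial.map (algebraMap A k))) hint
    rw [hspan] at hdom
    have hrad' : (FI.map (MvPolynomial.map (algebraMap A k))).IsRadical :=
      ((Ideal.Quotient.isDomain_iff_prime _).mp hdom).isRadical
    rw [hspan]
    exact map_eq_of_C_mul_pow_mem hFJ G hG (fun g hg => ⟨m g hg, a g hg, hφ' g hg, hmem g hg⟩) hrad'
  -- ### Case 1: `rad = ⊤` — the fibres near the generic point are empty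
  by_cases htop : rad = ⊤
  · refine ⟨a₃, ha₃0, fun k _ φ hφ hint => ?_⟩
    exfalso
    letI := φ.toAlgebra
    have hJF := key k hφ hint
    have hJtop : J = ⊤ := by rw [hJdef, htop, Ideal.comap_top]
    have hbot : polyBaseChange J k = ⊤ := by
      show J.map _ = ⊤
      rw [hJtop, Ideal.map_top]
    rw [hbot] at hJF
    haveI : Subsingleton (MvPolynomial (Fin n) k ⧸ Ideal.span ((F.image (MvPolynomial.map (algebraMap A k)) :
        Finset (MvPolynomial (Fin n) k)) : Set (MvPolynomial (Fin n) k))) :=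
      Ideal.Quotient.subsingleton_iff.mpr hJF.symm
    haveI : IsEmpty (affineZeroLocus k n (F.image (MvPolynomial.map (algebraMap A k)))) :=
      inferInstanceAs (IsEmpty (PrimeSpectrum (MvPolynomial (Fin n) k ⧸ _)))
    obtain ⟨x⟩ := hint.nonempty
    exact IsEmpty.false x
  -- ### Case 2: `rad` not prime — the fibres near the generic point are not integral
  by_cases hprime : ¬ rad.IsPrime
  · rw [Ideal.not_isPrime_iff] at hprime
    rcases hprime with h | ⟨t₁, ht₁, t₂, ht₂, h12⟩
    · exact absurd h htop
    -- rescale `t₁`, `t₂` into `ψ((MvPolynomial (Fin n) A))`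
    obtain ⟨⟨r₁, m₁⟩, hrm₁⟩ := IsLocalization.surj ((nonZeroDivisors A).map (C : A →+* (MvPolynomial (Fin n) A))) t₁
    obtain ⟨⟨r₂, m₂⟩, hrm₂⟩ := IsLocalization.surj ((nonZeroDivisors A).map (C : A →+* (MvPolynomial (Fin n) A))) t₂
    obtain ⟨c₁, hc₁, hm₁⟩ := m₁.2
    obtain ⟨c₂, hc₂, hm₂⟩ := m₂.2
    have hu₁ : IsUnit (ψ m₁) := by rw [← hm₁]; exact isUnit_algebraMap_C K (nonZeroDivisors.ne_zero hc₁)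
    have hu₂ : IsUnit (ψ m₂) := by rw [← hm₂]; exact isUnit_algebraMap_C K (nonZeroDivisors.ne_zero hc₂)
    have hr₁ : ψ r₁ = t₁ * ψ m₁ := hrm₁.symm
    have hr₂ : ψ r₂ = t₂ * ψ m₂ := hrm₂.symm
    -- primes above `rad` avoiding `t₁`, `t₂`
    have hexq : ∀ t, t ∉ rad → ∃ 𝔮 : Ideal (MvPolynomial (Fin n) K), 𝔮.IsPrime ∧ rad ≤ 𝔮 ∧ t ∉ 𝔮 := by
      intro t ht
      by_contra hall
      apply ht
      rw [hraddef, Ideal.radical_eq_sInf, Submodule.mem_sInf]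
      rintro 𝔮 ⟨h1, h2⟩
      by_contra ht𝔮
      exact hall ⟨𝔮, h2, by rw [hraddef]; exact h2.radical_le_iff.mpr h1, ht𝔮⟩
    obtain ⟨𝔮₁, h𝔮₁, hle₁, ht𝔮₁⟩ := hexq t₁ ht₁
    obtain ⟨𝔮₂, h𝔮₂, hle₂, ht𝔮₂⟩ := hexq t₂ ht₂
    haveI := h𝔮₁
    haveI := h𝔮₂
    have hr𝔮₁ : ψ r₁ ∉ 𝔮₁ := by
      rw [hr₁]; exact fun h => ht𝔮₁ ((Ideal.mul_unit_mem_iff_mem _ hu₁).mp h)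
    have hr𝔮₂ : ψ r₂ ∉ 𝔮₂ := by
      rw [hr₂]; exact fun h => ht𝔮₂ ((Ideal.mul_unit_mem_iff_mem _ hu₂).mp h)
    obtain ⟨P₁, hP₁, hrP₁, hPA₁⟩ := exists_prime_quotient_of_prime K hle₁ hr𝔮₁
    obtain ⟨P₂, hP₂, hrP₂, hPA₂⟩ := exists_prime_quotient_of_prime K hle₂ hr𝔮₂
    have h12' : IsNilpotent ((Ideal.Quotient.mk J r₁) * (Ideal.Quotient.mk J r₂)) := by
      refine ⟨1, ?_⟩
      rw [pow_one, ← map_mul, Ideal.Quotient.eq_zero_iff_mem, hJdef, Ideal.mem_comap, map_mul,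
        hr₁, hr₂, mul_mul_mul_comm]
      exact Ideal.mul_mem_right _ _ h12
    obtain ⟨a₄, ha₄0, ha₄⟩ := exists_forall_not_isDomain_tensor (A := A) (B := (MvPolynomial (Fin n) A) ⧸ J) _ _ h12'
      ⟨P₁, hP₁, hrP₁, hPA₁⟩ ⟨P₂, hP₂, hrP₂, hPA₂⟩
    refine ⟨a₃ * a₄, mul_ne_zero ha₃0 ha₄0, fun k _ φ hφ hint => ?_⟩
    exfalso
    letI := φ.toAlgebra
    replace hφ : algebraMap A k (a₃ * a₄) ≠ 0 := hφ
    rw [map_mul] at hφ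
    have hJF := key k (left_ne_zero_of_mul hφ) hint
    apply ha₄ k (right_ne_zero_of_mul hφ)
    -- `((MvPolynomial (Fin n) A) ⧸ J) ⊗ k ≅ k[x] ⧸ (φF)`, a domain
    haveI hdom := isDomain_of_isIntegral_affineZeroLocus k
      (F.image (MvPolynomial.map (algebraMap A k))) hint
    exact MulEquiv.isDomain _ ((polyQuotientBaseChangeEquiv k J).toMulEquiv.trans
      (Ideal.quotEquivOfEq hJF).toMulEquiv)
  rw [not_not] at hprime
  haveI := hprime
  -- ### Case 3: `rad` prime — the model theorem
  obtain ⟨S', hS'⟩ := (inferInstance : IsNoetherianRing (MvPolynomial (Fin n) K)).noetherian rad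
  have hS'' : Ideal.span (S' : Set (MvPolynomial (Fin n) K)) = rad := hS'
  have hres' : HasMarkedResolution K n S' := hres S' (by rw [hS'']; exact hprime)
  obtain ⟨a₅, ha₅0, ha₅⟩ := exists_forall_hasResolution_pullback (A := A) K rad S' hS'' hres'
  refine ⟨a₃ * a₅, mul_ne_zero ha₃0 ha₅0, fun k _ φ hφ hint => ?_⟩
  letI := φ.toAlgebra
  replace hφ : algebraMap A k (a₃ * a₅) ≠ 0 := hφ
  rw [map_mul] at hφ
  have hJF := key k (left_ne_zero_of_mul hφ) hint
  obtain ⟨e, he⟩ := exists_isIso_affineZeroLocus_pullback J k _ hJF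
  haveI := he
  haveI : IsIntegral (affineZeroLocus k n (F.image (MvPolynomial.map (algebraMap A k)))) := hint
  obtain ⟨x₀⟩ := hint.nonempty
  haveI : Nonempty (↥(pullback (Spec.map (CommRingCat.ofHom (algebraMap A ((MvPolynomial (Fin n) A) ⧸ J))))
      (Spec.map (CommRingCat.ofHom (algebraMap A k))))) := ⟨e x₀⟩
  have hint' : IsIntegral (pullback (Spec.map (CommRingCat.ofHom (algebraMap A ((MvPolynomial (Fin n) A) ⧸ J))))
      (Spec.map (CommRingCat.ofHom (algebraMap A k)))) := isIntegral_of_isOpenImmersion (inv e)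
  exact (ha₅ k (right_ne_zero_of_mul hφ) hint').of_iso (inv e)

end Spread

/-! ## The assembly: Noetherian induction on `Spec ℤ[c]` -/

open scoped Classical in
/-- **BGMW 2011, Cor. 8.0.6 (the form `BierstoneGrigorievMilmanWlodarczyk2011`) from
resolution of marked ideals in characteristic zero** ((C0): for every field `K` of
characteristic zero and every finite `S ⊆ K[x₁, …, xₙ]` the marked ideal `(𝔸ⁿ_K, 𝓘_{V(S)}, ∅, 1)`
has a resolution — the hypothesis `h0`, a special case of Kollár's Thm. 3.69 and supplied from it
by `charZeroMarkedResolution_of_kollar`), with a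
non-explicit bound `M(d, n, l)`: Noetherian induction on `Spec ℤ[c]`
(`exists_bound_forall_prime_of_generic`, `LargeCharacteristic.lean`), the goodness of a prime
`𝔭` being "every INTEGRAL instance at a field-valued point with kernel `𝔭` has a resolution";
at a prime `𝔮` of residue characteristic zero the instances near the generic point of `V(𝔮)`
are resolved by `exists_forall_hasResolution_affineZeroLocus` over `A = ℤ[c] ⧸ 𝔮`.
[cite: BierstoneGrigorievMilmanWlodarczyk2011, Cor. 8.0.6] -/
theorem bierstoneGrigorievMilmanWlodarczyk2011_of_charZero
    (h0 : ∀ (K : Type) [Field K] [CharZero K] (n : ℕ) (S : Finset (MvPolynomial (Fin n) K)),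
      HasMarkedResolution K n S) :
    BierstoneGrigorievMilmanWlodarczyk2011 := by
  classical
  let Good : ∀ n d l : ℕ, Ideal (CoeffRing n d l) → Prop := fun n d l 𝔭 =>
    ∀ (k : Type) [Field k] (φ : CoeffRing n d l →+* k), RingHom.ker φ = 𝔭 →
      IsIntegral (affineZeroLocus k n (univFamily n d l φ)) →
      Scheme.HasResolution (affineZeroLocus k n (univFamily n d l φ))
  have hbound : ∀ n d l : ℕ, ∃ M : ℕ, ∀ 𝔭 : Ideal (CoeffRing n d l), 𝔭.IsPrime →
      (∀ p : ℕ, p.Prime → (p : CoeffRing n d l) ∈ 𝔭 → M < p) → Good n d l 𝔭 := by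
    intro n d l
    refine exists_bound_forall_prime_of_generic (Good n d l) fun 𝔮 h𝔮 hchar => ?_
    haveI := h𝔮
    haveI := charZero_fractionRing_quotient 𝔮 hchar
    haveI : IsDomain (CoeffRing n d l ⧸ 𝔮) := Ideal.Quotient.isDomain 𝔮
    -- spread over `A = ℤ[c] ⧸ 𝔮`
    obtain ⟨aq, haq0, haq⟩ := exists_forall_hasResolution_affineZeroLocus
      (A := CoeffRing n d l ⧸ 𝔮) (FractionRing (CoeffRing n d l ⧸ 𝔮))
      (fun S' _ => h0 _ n S') (univFamily n d l (Ideal.Quotient.mk 𝔮))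
    obtain ⟨f, rfl⟩ := Ideal.Quotient.mk_surjective aq
    refine ⟨f, fun hf => haq0 (Ideal.Quotient.eq_zero_iff_mem.mpr hf), fun 𝔭 _ hle hf𝔭 k _ φ hker => ?_⟩
    -- `φ` factors through `ℤ[c] ⧸ 𝔮`
    have h𝔮φ : ∀ c ∈ 𝔮, φ c = 0 := fun c hc => by
      rw [← RingHom.mem_ker, hker]; exact hle hc
    let φq : CoeffRing n d l ⧸ 𝔮 →+* k := Ideal.Quotient.lift 𝔮 φ h𝔮φ
    have hφq : φq.comp (Ideal.Quotient.mk 𝔮) = φ := RingHom.ext fun c => Ideal.Quotient.lift_mk 𝔮 φ h𝔮φ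
    have hfam : univFamily n d l φ =
        (univFamily n d l (Ideal.Quotient.mk 𝔮)).image (MvPolynomial.map φq) := by
      rw [← univFamily_comp, hφq]
    rw [hfam]
    refine haq k φq ?_
    change φq (Ideal.Quotient.mk 𝔮 f) ≠ 0
    rw [Ideal.Quotient.lift_mk]
    exact fun h => hf𝔭 (hker ▸ (RingHom.mem_ker).mpr h)
  choose M hM using hbound
  refine ⟨fun d n l => M n d l, fun p hp k _ _ _ n d l S hS hd hMp hint => ?_⟩
  have hgood : Good n d l (RingHom.ker (coeffHom (d := d) (l := l) S)) :=
    hM n d l _ (RingHom.ker_isPrime _) fun q hq hqk => lt_of_prime_mem_ker_coeffHom S hMp hq hqk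
  -- `V(S)` is the instance at `coeffHom S` (same ideal)
  have hspan := span_univFamily_coeffHom S hS hd
  have transfer : ∀ (I₁ I₂ : Ideal (MvPolynomial (Fin n) k)), I₁ = I₂ →
      (IsIntegral (Spec (CommRingCat.of (MvPolynomial (Fin n) k ⧸ I₁))) →
        Scheme.HasResolution (Spec (CommRingCat.of (MvPolynomial (Fin n) k ⧸ I₁)))) →
      IsIntegral (Spec (CommRingCat.of (MvPolynomial (Fin n) k ⧸ I₂))) →
        Scheme.HasResolution (Spec (CommRingCat.of (MvPolynomial (Fin n) k ⧸ I₂))) := by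
    rintro _ _ rfl h
    exact h
  exact transfer _ _ hspan (hgood k (coeffHom S) rfl) hint

/-- **`BierstoneGrigorievMilmanWlodarczyk2011` from Kollár's Thm. 3.69**
(`Kollar2007MarkedOrderReduction`, through `charZeroMarkedResolution_of_kollar`): on this line the
large-characteristic fact rests only on resolution in characteristic zero and on spreading out.
[cite: BierstoneGrigorievMilmanWlodarczyk2011, Cor. 8.0.6] -/
theorem bierstoneGrigorievMilmanWlodarczyk2011_of_kollar (h : Kollar2007MarkedOrderReduction.{0}) :
    BierstoneGrigorievMilmanWlodarczyk2011 :=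
  bierstoneGrigorievMilmanWlodarczyk2011_of_charZero (charZeroMarkedResolution_of_kollar h)

end Literature.AlgebraicGeometry.Resolution

end
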